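import Summits.CriticalPhenomena.PercolationContinuityZ3.Theorems.PercNearOneGluingNoHeavyLowerTailSahiGridPatternRounding
import Summits.CriticalPhenomena.PercolationContinuityZ3.Theorems.PercNearOneGluingNoHeavyLowerTailSahiGridPatternShadowTPPTwisted

/-!
# `NoHeavyLowerTail` (crux stmt-CriticalPhenomena-4575), Sahi programme P1: the rounding calculus, part 3 —
# **RESOLVED TRIPLES ARE TWISTED BOOLEAN SHADOWS**: `ResolvedPos d ⟺` twisted three-partition positivity on `d` letters, hence
# `RoundingAlternative d → (PatternPos d ⟺ ∀ τ, threePartNT τ ≥ 0 on up-families of Fin d)`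

Support file (seat `prim-sahi-p1`, generation 12; `--supports stmt-CriticalPhenomena-4575`).  Pure proofs; one bookkeeping definition
(`twistU τ x`, the twisted up-set of letters read off a point); no `sorry`, standard axioms.  Vocabulary of `…SahiGridPatternRounding`
(`AxInv`, `axSwap`, `lo`, `hi`, `Resolved`, `ResolvedPos`, `RoundingAlternative`, `patternPos_of_roundingAlternative`) and
`…ShadowTPPTwisted` (`sStarD_twistedShadow_eq`, `isUpperSet_twistedShadow`, `threePartNT_nonneg_of_patternPos`; `threePartNT` of
`…ThreePartitionADTwisted`).

THE MATHEMATICS.  A triple `(A,B,C)` of up-sets of `[3]^d` resolved on every axis (`Resolved`: all three invariant under the value transposition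
`(0 1)`, or all three under `(1 2)`, axis by axis) is a TWISTED BOOLEAN SHADOW: with `τ = {a : the axis is resolved through (1 2)}` and
`U_τ(x) = {a ∉ τ : x_a = 2} ∪ {a ∈ τ : x_a ≠ 0}` (`twistU`), membership in each set depends on `x` only through `U_τ(x)`
(`mem_iff_of_twistU_eq`: two points with the same `U_τ` differ by a product of the transpositions the sets are blind to — induction on the
Hamming distance), the families `𝒰_X = U_τ(X)` are up-sets of `𝒫([d])` (`isUpperSet_shadowFamily`), and `sStarD A B C = 2^d · threePartNT τ 𝒰_A 𝒰_B 𝒰_C`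
(generation 10's `sStarD_twistedShadow_eq`).  Hence **`resolvedPos_iff_twistedTPP`**: `ResolvedPos d ⟺ (∀ τ 𝒰 𝒱 𝒲 up-families, 0 ≤ threePartNT τ 𝒰 𝒱 𝒲)`,
and with part 1: **`patternPos_iff_twistedTPP_of_roundingAlternative`**: under `RoundingAlternative d`, the pattern inequality on `[3]^d`
(equivalently Lieb–Sahi's `C₃` on `[0,1]^d`, Kahn's Conjecture 5 on `d`-dimensional products) is EQUIVALENT to the finite Boolean statement of
twisted three-partition positivity on `d` letters.
HONEST LABEL: `RoundingAlternative d` is OPEN (seat evidence only); nothing here asserts `PatternPos d` (`d ≥ 4`), Kahn's or Sahi's conjecture. [this work]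
-/

namespace Summit.CriticalPhenomena.PercolationContinuityZ3.Theorems.SahiGridPattern

open Finset
open scoped Classical
open Summit.CriticalPhenomena.PercolationContinuityZ3.Theorems.ThreePartition (threePartNT)

variable {d : ℕ}

/-- The twisted up-set of letters read off a point: `U_τ(x) = {a ∉ τ : x_a = 2} ∪ {a ∈ τ : x_a ≠ 0}`. [this work] -/
def twistU (τ : Set (Fin d)) (x : Pd d) : Set (Fin d) := {a : Fin d | (a ∉ τ ∧ x a = 2) ∨ (a ∈ τ ∧ x a ≠ 0)}

/-- The blindness hypothesis of a twist: off `τ` the set does not distinguish the values `0,1`, on `τ` it does not distinguish `1,2`.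
[this work] -/
theorem lo_zero : lo (0 : Fin 2) = 0 := rfl

/-- `hi 0 = 1`. [this work] -/
theorem hi_zero : hi (0 : Fin 2) = 1 := rfl

/-- `lo 1 = 1`. [this work] -/
theorem lo_one : lo (1 : Fin 2) = 1 := rfl

/-- `hi 1 = 2`. [this work] -/
theorem hi_one : hi (1 : Fin 2) = 2 := rfl

/-- Two points with the same twisted letter set lie in the same blind sets: if `X` is `(0 1)`-invariant on every axis off `τ` and
`(1 2)`-invariant on every axis in `τ`, then `U_τ x = U_τ y → (x ∈ X ↔ y ∈ X)`.  (Induction on the number of coordinates where `x, y` differ.)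
[this work] -/
theorem mem_iff_of_twistU_eq (τ : Set (Fin d)) {X : Finset (Pd d)}
    (h0 : ∀ a, a ∉ τ → AxInv a 0 1 X) (h1 : ∀ a, a ∈ τ → AxInv a 1 2 X) :
    ∀ x y : Pd d, twistU τ x = twistU τ y → (x ∈ X ↔ y ∈ X) := by
  suffices key : ∀ n : ℕ, ∀ x y : Pd d, (univ.filter fun a => x a ≠ y a).card ≤ n → twistU τ x = twistU τ y → (x ∈ X ↔ y ∈ X) by
    intro x y hxy; exact key _ x y le_rfl hxy
  intro n
  induction n with
  | zero =>
    intro x y hn _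
    have hxy : x = y := by
      funext a
      by_contra hne
      have : a ∈ univ.filter fun a => x a ≠ y a := by simp [hne]
      have : 0 < (univ.filter fun a => x a ≠ y a).card := card_pos.2 ⟨a, this⟩
      omega
    rw [hxy]
  | succ n ih =>
    intro x y hn hU
    by_cases hall : ∀ a, x a = y a
    · rw [show x = y from funext hall]
    · obtain ⟨a, ha⟩ := not_forall.1 hall
      have hUa : a ∈ twistU τ x ↔ a ∈ twistU τ y := by rw [hU]
      simp only [twistU, Set.mem_setOf_eq] at hUa
      -- the modified point y' agrees with x at a
      have main : ∀ (u v : Fin 3), AxInv a u v X → ((x a = u ∧ y a = v) ∨ (x a = v ∧ y a = u)) →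
          (x ∈ X ↔ y ∈ X) := by
        intro u v hinv hcase
        set y' := axSwap a u v y with hy'
        have hya : y' a = x a := by
          rcases hcase with ⟨hx, hy⟩ | ⟨hx, hy⟩
          · rw [hy', axSwap_apply_self, hy, Equiv.swap_apply_right, hx]
          · rw [hy', axSwap_apply_self, hy, Equiv.swap_apply_left, hx]
        have hyb : ∀ b, b ≠ a → y' b = y b := fun b hb => by rw [hy', axSwap_apply_ne hb]
        have hsub : (univ.filter fun b => x b ≠ y' b) ⊆ (univ.filter fun b => x b ≠ y b).erase a := by
          intro b hb
          simp only [mem_filter, mem_univ, true_and, mem_erase] at hb ⊢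
          refine ⟨?_, ?_⟩
          · rintro rfl; exact hb hya.symm
          · intro hxb; apply hb
            by_cases hba : b = a
            · subst hba; exact hya.symm
            · rw [hyb b hba]; exact hxb
        have hmem : a ∈ univ.filter fun b => x b ≠ y b := by simp [ha]
        have hcard : (univ.filter fun b => x b ≠ y' b).card ≤ n := by
          have := card_le_card hsub; rw [card_erase_of_mem hmem] at this; omega
        have hU' : twistU τ x = twistU τ y' := by
          rw [hU]; ext b
          simp only [twistU, Set.mem_setOf_eq]
          by_cases hba : b = a
          · subst hba
            rw [hya]
            exact hUa.symm
          · rw [hyb b hba]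
        rw [ih x y' hcard hU']
        exact (hinv y).symm
      by_cases hτ : a ∈ τ
      · -- both values nonzero, hence {1,2}
        have hx0 : x a ≠ 0 ∧ y a ≠ 0 ∨ (x a = 0 ∧ y a = 0) := by tauto
        have hvals : (x a = 1 ∧ y a = 2) ∨ (x a = 2 ∧ y a = 1) := by
          rcases hx0 with ⟨hx, hy⟩ | ⟨hx, hy⟩
          · revert ha hx hy; generalize x a = p; generalize y a = q; revert p q; decide
          · exact absurd (hx.trans hy.symm) ha
        exact main 1 2 (h1 a hτ) hvals
      · have hx2 : (x a = 2 ↔ y a = 2) := by tauto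
        have hvals : (x a = 0 ∧ y a = 1) ∨ (x a = 1 ∧ y a = 0) := by
          revert ha hx2; generalize x a = p; generalize y a = q; revert p q; decide
        exact main 0 1 (h0 a hτ) hvals

/-- The shadow family of a set: the twisted letter sets of its points. [this work] -/
theorem mem_shadowFamily_iff (τ : Set (Fin d)) {X : Finset (Pd d)}
    (h0 : ∀ a, a ∉ τ → AxInv a 0 1 X) (h1 : ∀ a, a ∈ τ → AxInv a 1 2 X) (x : Pd d) :
    x ∈ X ↔ twistU τ x ∈ {S : Set (Fin d) | ∃ y ∈ X, twistU τ y = S} := by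
  constructor
  · intro hx; exact ⟨x, hx, rfl⟩
  · rintro ⟨y, hy, hyx⟩
    exact (mem_iff_of_twistU_eq τ h0 h1 y x hyx).1 hy

/-- The shadow family of an up-set is an up-set of `𝒫([d])`. [this work] -/
theorem isUpperSet_shadowFamily (τ : Set (Fin d)) {X : Finset (Pd d)} (hX : IsUpperSet (X : Set (Pd d))) :
    IsUpperSet {S : Set (Fin d) | ∃ y ∈ X, twistU τ y = S} := by
  rintro S T hST ⟨y, hy, rfl⟩
  refine ⟨fun a => if a ∈ T then 2 else y a, ?_, ?_⟩
  · refine hX (show y ≤ fun a => if a ∈ T then 2 else y a from fun a => ?_) hy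
    by_cases ha : a ∈ T
    · simp only [ha, if_true]; exact Fin.le_last _
    · simp only [ha, if_false]; exact le_rfl
  · ext a
    simp only [twistU, Set.mem_setOf_eq]
    by_cases ha : a ∈ T
    · simp only [ha, if_true, iff_true]
      by_cases hτ : a ∈ τ <;> simp [hτ]
    · simp only [ha, if_false, iff_false]
      intro hmem
      exact ha (hST hmem)

/-- **Resolved triples satisfy the pattern inequality iff twisted three-partition positivity holds on `d` letters.** [this work] -/
theorem resolvedPos_iff_twistedTPP :
    ResolvedPos d ↔ ∀ (τ : Set (Fin d)) (𝒰 𝒱 𝒲 : Set (Set (Fin d))), IsUpperSet 𝒰 → IsUpperSet 𝒱 → IsUpperSet 𝒲 →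
      0 ≤ threePartNT τ 𝒰 𝒱 𝒲 := by
  constructor
  · intro hRP τ 𝒰 𝒱 𝒲 h𝒰 h𝒱 h𝒲
    set A : Finset (Pd d) := univ.filter fun x : Pd d => {a : Fin d | (a ∉ τ ∧ x a = 2) ∨ (a ∈ τ ∧ x a ≠ 0)} ∈ 𝒰 with hAdef
    set B : Finset (Pd d) := univ.filter fun x : Pd d => {a : Fin d | (a ∉ τ ∧ x a = 2) ∨ (a ∈ τ ∧ x a ≠ 0)} ∈ 𝒱 with hBdef
    set C : Finset (Pd d) := univ.filter fun x : Pd d => {a : Fin d | (a ∉ τ ∧ x a = 2) ∨ (a ∈ τ ∧ x a ≠ 0)} ∈ 𝒲 with hCdef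
    have hmem : ∀ (𝒳 : Set (Set (Fin d))) (x : Pd d),
        x ∈ (univ.filter fun x : Pd d => {a : Fin d | (a ∉ τ ∧ x a = 2) ∨ (a ∈ τ ∧ x a ≠ 0)} ∈ 𝒳) ↔ twistU τ x ∈ 𝒳 := by
      intro 𝒳 x; simp [twistU]
    -- the shadow sets are resolved on every axis
    have hres : ∀ (𝒳 : Set (Set (Fin d))) (a : Fin d),
        (a ∉ τ → AxInv a 0 1 (univ.filter fun x : Pd d => {a : Fin d | (a ∉ τ ∧ x a = 2) ∨ (a ∈ τ ∧ x a ≠ 0)} ∈ 𝒳)) ∧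
        (a ∈ τ → AxInv a 1 2 (univ.filter fun x : Pd d => {a : Fin d | (a ∉ τ ∧ x a = 2) ∨ (a ∈ τ ∧ x a ≠ 0)} ∈ 𝒳)) := by
      intro 𝒳 a
      have hU : ∀ (u v : Fin 3) (x : Pd d), (a ∉ τ → u ≠ 2 ∧ v ≠ 2) → (a ∈ τ → u ≠ 0 ∧ v ≠ 0) →
          twistU τ (axSwap a u v x) = twistU τ x := by
        intro u v x hoff hon
        ext b
        simp only [twistU, Set.mem_setOf_eq]
        by_cases hba : b = a
        · subst hba
          rw [axSwap_apply_self]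
          by_cases hτ : b ∈ τ
          · obtain ⟨hu, hv⟩ := hon hτ
            have : (Equiv.swap u v (x b) ≠ 0 ↔ x b ≠ 0) := by
              by_cases h1 : x b = u
              · rw [h1, Equiv.swap_apply_left]; exact ⟨fun _ => hu, fun _ => hv⟩
              · by_cases h2 : x b = v
                · rw [h2, Equiv.swap_apply_right]; exact ⟨fun _ => hv, fun _ => hu⟩
                · rw [Equiv.swap_apply_of_ne_of_ne h1 h2]
            simp only [hτ, not_true_eq_false, false_and, true_and, false_or, this]
          · obtain ⟨hu, hv⟩ := hoff hτ
            have : (Equiv.swap u v (x b) = 2 ↔ x b = 2) := by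
              by_cases h1 : x b = u
              · rw [h1, Equiv.swap_apply_left]; exact ⟨fun h => absurd h hv, fun h => absurd h hu⟩
              · by_cases h2 : x b = v
                · rw [h2, Equiv.swap_apply_right]; exact ⟨fun h => absurd h hu, fun h => absurd h hv⟩
                · rw [Equiv.swap_apply_of_ne_of_ne h1 h2]
            simp only [hτ, not_false_eq_true, true_and, false_and, or_false, this]
        · rw [axSwap_apply_ne hba]
      refine ⟨fun hτ x => ?_, fun hτ x => ?_⟩
      · rw [hmem, hmem, hU 0 1 x (fun _ => ⟨by decide, by decide⟩) (fun h => absurd h hτ)]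
      · rw [hmem, hmem, hU 1 2 x (fun h => absurd hτ h) (fun _ => ⟨by decide, by decide⟩)]
    have hresolved : ∀ a, Resolved a A B C := by
      intro a
      by_cases hτ : a ∈ τ
      · exact ⟨1, (hres 𝒰 a).2 hτ, (hres 𝒱 a).2 hτ, (hres 𝒲 a).2 hτ⟩
      · exact ⟨0, (hres 𝒰 a).1 hτ, (hres 𝒱 a).1 hτ, (hres 𝒲 a).1 hτ⟩
    have hS := hRP A B C (isUpperSet_twistedShadow τ h𝒰) (isUpperSet_twistedShadow τ h𝒱) (isUpperSet_twistedShadow τ h𝒲) hresolved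
    rw [sStarD_twistedShadow_eq τ 𝒰 𝒱 𝒲 (fun x => by simp [A]) (fun x => by simp [B]) (fun x => by simp [C])] at hS
    exact (mul_nonneg_iff_of_pos_left (by positivity : (0:ℤ) < 2 ^ d)).1 hS
  · intro hT A B C hA hB hC hres
    choose j hj using hres
    set τ : Set (Fin d) := {a | j a = 1} with hτdef
    have hinv : ∀ X : Finset (Pd d), (∀ a, AxInv a (lo (j a)) (hi (j a)) X) →
        (∀ a, a ∉ τ → AxInv a 0 1 X) ∧ (∀ a, a ∈ τ → AxInv a 1 2 X) := by
      intro X hX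
      refine ⟨fun a ha => ?_, fun a ha => ?_⟩
      · have hj0 : j a = 0 := by
          have : ¬ j a = 1 := ha
          revert this; generalize j a = q; revert q; decide
        have := hX a; rw [hj0] at this; exact this
      · have hj1 : j a = 1 := ha
        have := hX a; rw [hj1] at this; exact this
    obtain ⟨hA0, hA1⟩ := hinv A fun a => (hj a).1
    obtain ⟨hB0, hB1⟩ := hinv B fun a => (hj a).2.1
    obtain ⟨hC0, hC1⟩ := hinv C fun a => (hj a).2.2
    rw [sStarD_twistedShadow_eq τ {S | ∃ y ∈ A, twistU τ y = S} {S | ∃ y ∈ B, twistU τ y = S} {S | ∃ y ∈ C, twistU τ y = S}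
      (mem_shadowFamily_iff τ hA0 hA1) (mem_shadowFamily_iff τ hB0 hB1) (mem_shadowFamily_iff τ hC0 hC1)]
    exact mul_nonneg (by positivity)
      (hT τ _ _ _ (isUpperSet_shadowFamily τ hA) (isUpperSet_shadowFamily τ hB) (isUpperSet_shadowFamily τ hC))

/-- **Under the rounding alternative, the pattern inequality on `[3]^d` is EQUIVALENT to twisted three-partition positivity on `d`
letters.** [this work] -/
theorem patternPos_iff_twistedTPP_of_roundingAlternative (hRA : RoundingAlternative d) :
    PatternPos d ↔ ∀ (τ : Set (Fin d)) (𝒰 𝒱 𝒲 : Set (Set (Fin d))), IsUpperSet 𝒰 → IsUpperSet 𝒱 → IsUpperSet 𝒲 →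
      0 ≤ threePartNT τ 𝒰 𝒱 𝒲 :=
  ⟨fun hP τ _ _ _ h𝒰 h𝒱 h𝒲 => threePartNT_nonneg_of_patternPos hP τ h𝒰 h𝒱 h𝒲,
    fun hT => patternPos_of_roundingAlternative hRA (resolvedPos_iff_twistedTPP.2 hT)⟩

/-- In particular, under the rounding alternative, UNTWISTED-and-twisted three-partition positivity on `d` letters gives Sahi's `C₃` on every
`d`-dimensional grid with a product weight (homogeneous form) and Lieb–Sahi's inequality on `[0,1]^d` at order `3`. [this work] -/
theorem liebSahiContinuum_of_roundingAlternative_of_twistedTPP (hRA : RoundingAlternative d)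
    (hT : ∀ (τ : Set (Fin d)) (𝒰 𝒱 𝒲 : Set (Set (Fin d))), IsUpperSet 𝒰 → IsUpperSet 𝒱 → IsUpperSet 𝒲 →
      0 ≤ threePartNT τ 𝒰 𝒱 𝒲) : LiebSahiContinuum d 3 :=
  liebSahiContinuum_of_patternPos ((patternPos_iff_twistedTPP_of_roundingAlternative hRA).2 hT)

end Summit.CriticalPhenomena.PercolationContinuityZ3.Theorems.SahiGridPattern
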